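import Summits.BirchSwinnertonDyer.BirchSwinnertonDyer.Theorems.CMKolyvaginAtInertTwoGenusDefectDeepWitnessAtTwo
import Summits.BirchSwinnertonDyer.BirchSwinnertonDyer.Theorems.GenusKolyvaginAtTwoPowDvdShaCardAtTwoRTBottomRungParity
import HarnessLib

/-!
# Route `CMKolyvaginAtInertTwo`, crux `CMKolyvaginExactAtInertTwo` (stmt-BirchSwinnertonDyer-24277) —
# THE REFUTATION SCHEMA FOR `Σ ≥ 2` WITH POINT-DIVISIBILITY HYPOTHESES ONLY (what a numerical search must certify)

Seat `bsd-line-cmk2-p1` g20 (cell `bsd-print-cf2`), `--supports stmt-BirchSwinnertonDyer-24277` (helper; closes nothing).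
THEOREMS ONLY (no definition, no named fact, no `sorry`).  BSD is NOT proved by this; NO counterexample is exhibited here.

File `…GenusDefectDeepWitnessAtTwo` shows: a level-`4` Gross witness (`addOrderOf c₂(e₀) = 4`) on an H₂ frame gives
`#Ш(E_K)(2)·2 = 2^{2M₀+Σ}` (mod the five prints), so with `Σ ≥ 2` and a primitive certificate the crux as stated fails.  Here the
witness hypothesis is put in the NUMERICALLY CHECKABLE currency `P(n₀) ∉ 2E(K[n₀])` (McCallum Cor. 4.5 at `2`:
`RelaxedCount.addOrderOf_kolyvaginClass_two_eq_pow_of_not_two_dvd_single`), the free level/margin parameters are fixed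
(`L := 2M₀ + 12`, `k := 1`), and ONE square-free `n₀` of CM-inert Zhang–Kolyvagin primes of index `≥ 2` with `Frob_ℓ = Frob_∞` on `K(E[4])`
serves both as the crux's certificate and as the deep witness.

* `card_primaryComponent_sha_two_baseChange_mul_two_eq_of_primitive_deep_of_printedInputs` — `#Ш(E_K)(2)·2 = 2^{2M₀+Σ}` from
  `P(n₀) ∉ 2E(K[n₀])` at a deep `n₀`;
* `not_cmKolyvaginExactAtInertTwo_of_primitive_deep_of_two_le_sum_defect` — the schema: INPUT an H₂ curve `W` (CM, `2` inert in the CM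
  field, `ρ̄_{E,2}` onto, odd `∏ c_p`), an imaginary quadratic `K` (odd `d_K ≠ −3`, Heegner for `N_W`, `d_K·(−|Δ|)` and `d_K·(−2|Δ|)`
  non-squares, **`Σ ≥ 2`**), `y_K = P(1)` non-torsion with `2^{M₀} ∥ P(1)` in `E(K[1])`, and ONE square-free `n₀` whose primes `ℓ` are
  Zhang–Kolyvagin at `2`, inert in the CM field, with `4 ∣ ℓ+1`, `4 ∣ a_ℓ` and `Frob_ℓ = Frob_∞` on `K(E[4])`, such that
  `P(n₀) ∉ 2E(K[n₀])`; OUTPUT `¬ CMKolyvaginExactAtInertTwo` — modulo GZ / GZK / modularity / Milne any-model and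
  `prop37_2_reductionCongruence_inert N_W W K`.

References: [McCallumLMS1991] §4 Cor. 4.5, §5 Thm. 5.4; [GrossLMS1991] Prop. 3.7 (2), §5; [DokchitserDokchitserAnnals2010] Lemma 4.14;
[Kramer1981] Prop. 3.
-/

set_option autoImplicit false
-- the Theorems namespace of this sub repeats the summit name by design (D-0017 nested layout)
set_option linter.dupNamespace false

noncomputable section

open scoped Classical

namespace Summit.BirchSwinnertonDyer.BirchSwinnertonDyer.Theorems.KolyvaginGenusTwo

open WeierstrassCurve NumberField IsDedekindDomain Field AddSubgroup
open Literature.NumberTheory.EllipticCurves Literature.NumberTheory.GaloisRepresentations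
open Literature.NumberTheory.EllipticCurves.ModularForms Literature.NumberTheory.EllipticCurves.RingClassField
open Literature.NumberTheory.EllipticCurves.GrossLMS1991 (prop37_2_reductionCongruence_inert)
open Summit.BirchSwinnertonDyer.BirchSwinnertonDyer.Theses.CMKolyvaginAtInertTwo (CMKolyvaginExactAtInertTwo)
open Summit.BirchSwinnertonDyer.BirchSwinnertonDyer.Theorems.GenusExact
open Summit.BirchSwinnertonDyer.Rank1Residual

/-- **`#Ш(E_K)[2^∞]·2 = 2^{2M₀+Σ}` FROM A PRIMITIVE DEEP PRODUCT** (`P(n₀) ∉ 2E(K[n₀])`, all primes of `n₀` Zhang–Kolyvagin of index `≥ 2`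
with `Frob = Frob_∞` on `K(E[4])`), on H₂ with any odd `d_K ≠ −3`, modulo the five prints: McCallum Cor. 4.5 at `2`
(`addOrderOf c₂(e₀) = 4`) + `card_primaryComponent_sha_two_baseChange_mul_two_eq_of_grossWitness_of_printedInputs` at `L = 2M₀+12`, `k = 1`.
[cite: McCallumLMS1991, §4 Cor. 4.5, §5 Thm. 5.4] [cite: DokchitserDokchitserAnnals2010, Lemma 4.14 (proof)] [cite: Kramer1981, Prop. 3] -/
theorem card_primaryComponent_sha_two_baseChange_mul_two_eq_of_primitive_deep_of_printedInputs
    (hGZ : ∀ (N : ℕ) [NeZero N] (W : WeierstrassCurve ℚ) (K : Type) [Field K] [NumberField K], gross_zagier N W K)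
    (hGZK : rank_eq_analyticRank_of_analyticRank_le_one) (hmod : hasEntireLFunction_rat)
    (hMilneC : Milne1972.bsdQuotient_baseChange_quadratic_anyModel)
    (W : WeierstrassCurve ℚ) [W.IsElliptic] [W.IsGloballyMinimal] [NeZero (W.conductorNorm ℤ)]
    (hCM : W.HasCM) (hin : Rank1Residual.CMInert W 2) (hρ2 : W.HasSurjectiveModNGaloisRep 2)
    (hT : Odd W.tamagawaProduct) (K : Type) [Field K] [NumberField K] (hIQ : IsImaginaryQuadratic K)
    (hodd : Odd (NumberField.discr K)) (h3 : NumberField.discr K ≠ -3) (hHe : SatisfiesHeegnerHypothesis (W.conductorNorm ℤ) K)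
    (h37 : prop37_2_reductionCongruence_inert (W.conductorNorm ℤ) W K)
    (Dt : ModularParametrizationData W (W.conductorNorm ℤ)) (β : ℤ) (ι : K →+* ℂ) (d₁ : KolyvaginHeegnerData Dt β ι 1)
    (hy : ¬ IsOfFinAddOrder d₁.derivedPoint) (M₀ : ℕ)
    (hM₀ : ∃ Q : (W.baseChange (ringClassField K ι 1)).toAffine.Point, ((2 ^ M₀ : ℕ) : ℤ) • Q = d₁.derivedPoint)
    (hndiv : ¬ ∃ Q : (W.baseChange (ringClassField K ι 1)).toAffine.Point, ((2 ^ (M₀ + 1) : ℕ) : ℤ) • Q = d₁.derivedPoint)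
    {n₀ : ℕ} (hn₀ : Squarefree n₀)
    (hn₀K : ∀ q ∈ n₀.primeFactors, Zhang2014.IsKolyvaginPrime (W.conductorNorm ℤ) W K 2 q ∧ 2 ≤ Zhang2014.kolyvaginIndex W 2 q ∧
      FrobEqFrobInfty W K (2 ^ 2) q)
    (e₀ : KolyvaginHeegnerData Dt β ι n₀)
    (hPn₀ : ¬ ∃ Q : (W.baseChange (ringClassField K ι n₀)).toAffine.Point, (2 : ℤ) • Q = e₀.derivedPoint) :
    Nat.card (AddCommGroup.primaryComponent (W.baseChange K).sha 2) * 2 =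
      2 ^ (2 * M₀ + ∑ q ∈ (NumberField.discr K).natAbs.primeFactors,
        ((if jacobiSym W.Δ.num q = -1 then 1 else 0) +
          (if jacobiSym W.Δ.num q = 1 ∧ Even (W.frobeniusTrace q) then 2 else 0))) := by
  haveI : ∀ j : ℕ, NumberField (ringClassField K ι j) := JET.numberField_ringClassField K hIQ ι
  have he₀ : addOrderOf (e₀.kolyvaginClass Nat.prime_two 2) = 2 ^ 2 :=
    RelaxedCount.addOrderOf_kolyvaginClass_two_eq_pow_of_not_two_dvd_single W hIQ hodd h3 hHe hρ2 Dt β ι (M := 2) (by norm_num) hn₀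
      (fun q hq ↦ ⟨(hn₀K q hq).1, (hn₀K q hq).2.1⟩) e₀ hPn₀
  exact card_primaryComponent_sha_two_baseChange_mul_two_eq_of_grossWitness_of_printedInputs hGZ hGZK hmod hMilneC W hCM hin hρ2 hT K hIQ
    hodd h3 hHe h37 Dt β ι d₁ hy M₀ hM₀ hndiv (L := 2 * M₀ + 12) (k := 1) le_rfl le_rfl hn₀ hn₀K e₀ he₀

/-- **THE REFUTATION SCHEMA FOR `Σ ≥ 2` (point-divisibility hypotheses only).**  INPUT: `W ∈ H₂` (CM, `2` inert in the CM field,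
`ρ̄_{E,2}` onto, odd `∏ c_p`); `K` imaginary quadratic with odd `d_K ≠ −3`, Heegner for `N_W`, `d_K·(−|Δ|)`, `d_K·(−2|Δ|)` non-squares and
**`Σ ≥ 2`**; a frame `(Dt, β, ι)`; `P(1) = y_K` of infinite order with `2^{M₀} ∥ P(1)` in `E(K[1])`; ONE square-free `n₀` all of whose primes
`ℓ` are Zhang–Kolyvagin at `2`, CM-inert, of index `≥ 2` (`4 ∣ ℓ + 1`, `4 ∣ a_ℓ`) with `Frob_ℓ = Frob_∞` on `K(E[4])`, and a datum `e₀` at `n₀`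
with `P(n₀) ∉ 2E(K[n₀])` (it is at once the crux's certificate and the deep witness).  OUTPUT: `¬ CMKolyvaginExactAtInertTwo`, modulo
GZ / GZK / modularity / Milne any-model and `prop37_2_reductionCongruence_inert N_W W K`.  No such input is constructed in the tree.
[cite: McCallumLMS1991, §4 Cor. 4.5, §5 Thm. 5.4] [cite: GrossLMS1991, Prop. 3.7 (2)] [cite: DokchitserDokchitserAnnals2010, Lemma 4.14 (proof)] -/
theorem not_cmKolyvaginExactAtInertTwo_of_primitive_deep_of_two_le_sum_defect
    (hGZ : ∀ (N : ℕ) [NeZero N] (W : WeierstrassCurve ℚ) (K : Type) [Field K] [NumberField K], gross_zagier N W K)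
    (hGZK : rank_eq_analyticRank_of_analyticRank_le_one) (hmod : hasEntireLFunction_rat)
    (hMilneC : Milne1972.bsdQuotient_baseChange_quadratic_anyModel)
    (W : WeierstrassCurve ℚ) [W.IsElliptic] [W.IsGloballyMinimal] [NeZero (W.conductorNorm ℤ)]
    (hCM : W.HasCM) (hin : Rank1Residual.CMInert W 2) (hρ2 : W.HasSurjectiveModNGaloisRep 2)
    (hT : Odd W.tamagawaProduct) (K : Type) [Field K] [NumberField K] (hIQ : IsImaginaryQuadratic K)
    (hodd : Odd (NumberField.discr K)) (h3 : NumberField.discr K ≠ -3) (hHe : SatisfiesHeegnerHypothesis (W.conductorNorm ℤ) K)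
    (hns₁ : ¬ IsSquare ((NumberField.discr K : ℚ) * -|W.Δ|)) (hns₂ : ¬ IsSquare ((NumberField.discr K : ℚ) * (-(2 * |W.Δ|))))
    (h37 : prop37_2_reductionCongruence_inert (W.conductorNorm ℤ) W K)
    (Dt : ModularParametrizationData W (W.conductorNorm ℤ)) (β : ℤ) (ι : K →+* ℂ) (d₁ : KolyvaginHeegnerData Dt β ι 1)
    (hy : ¬ IsOfFinAddOrder d₁.derivedPoint) (M₀ : ℕ)
    (hM₀ : ∃ Q : (W.baseChange (ringClassField K ι 1)).toAffine.Point, ((2 ^ M₀ : ℕ) : ℤ) • Q = d₁.derivedPoint)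
    (hndiv : ¬ ∃ Q : (W.baseChange (ringClassField K ι 1)).toAffine.Point, ((2 ^ (M₀ + 1) : ℕ) : ℤ) • Q = d₁.derivedPoint)
    {n₀ : ℕ} (hn₀ : Squarefree n₀)
    (hn₀K : ∀ q ∈ n₀.primeFactors, Zhang2014.IsKolyvaginPrime (W.conductorNorm ℤ) W K 2 q ∧ Rank1Residual.CMInert W q ∧
      2 ≤ Zhang2014.kolyvaginIndex W 2 q ∧ FrobEqFrobInfty W K (2 ^ 2) q)
    (e₀ : KolyvaginHeegnerData Dt β ι n₀)
    (hPn₀ : ¬ ∃ Q : (W.baseChange (ringClassField K ι n₀)).toAffine.Point, (2 : ℤ) • Q = e₀.derivedPoint)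
    (hSigma : 2 ≤ ∑ q ∈ (NumberField.discr K).natAbs.primeFactors,
        ((if jacobiSym W.Δ.num q = -1 then 1 else 0) +
          (if jacobiSym W.Δ.num q = 1 ∧ Even (W.frobeniusTrace q) then 2 else 0))) :
    ¬ CMKolyvaginExactAtInertTwo := fun hX ↦ by
  haveI : ∀ j : ℕ, NumberField (ringClassField K ι j) := JET.numberField_ringClassField K hIQ ι
  have he₀ : addOrderOf (e₀.kolyvaginClass Nat.prime_two 2) = 2 ^ 2 :=
    RelaxedCount.addOrderOf_kolyvaginClass_two_eq_pow_of_not_two_dvd_single W hIQ hodd h3 hHe hρ2 Dt β ι (M := 2) (by norm_num) hn₀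
      (fun q hq ↦ ⟨(hn₀K q hq).1, (hn₀K q hq).2.2.1⟩) e₀ hPn₀
  exact not_cmKolyvaginExactAtInertTwo_of_grossWitness_of_two_le_sum_defect hGZ hGZK hmod hMilneC W hCM hin hρ2 hT K hIQ hodd h3 hHe
    hns₁ hns₂ h37 Dt β ι d₁ hy M₀ hM₀ hndiv e₀ hn₀ (fun q hq ↦ ⟨(hn₀K q hq).1, (hn₀K q hq).2.1⟩) hPn₀ (L := 2 * M₀ + 12) (k := 1)
    le_rfl le_rfl hn₀ (fun q hq ↦ ⟨(hn₀K q hq).1, (hn₀K q hq).2.2⟩) e₀ he₀ hSigma hX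

end Summit.BirchSwinnertonDyer.BirchSwinnertonDyer.Theorems.KolyvaginGenusTwo

end
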